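import Summits.QuantumFields.YangMills.Theorems.UnitScaleTiltProp7LocalDivergenceComparison
import Summits.QuantumFields.YangMills.Theorems.UnitScaleTiltProp7DeltaEtaAlmostPositive
import HarnessLib

/-!
# Route `UnitScaleTilt`, crux K1 «MinimiserStabilityRegPr» (stmt-QuantumFields-19200), EX row `hGF` (curved member), the LOD line (★p1 g24 `LOCATE-L6-ASSEMBLY` §1
# Step I.2, ★★OWNER RULINGS №33 ∕ №34) — **PEN (L5a), FILE A (LETTERS): THE COVARIANT CURL `D¹_{U₀}` ((3.4)) UNDER A SIMULTANEOUS GAUGE CHANGE, ITS ZEROTH-ORDER CLOSENESS TO THE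
# FLAT CURL NEXT TO THE SUPPORT, AND THE HESSIAN DICTIONARY `re⟪X̃, Δ^η(W)X̃⟫ = c₀η⁻²·(CURL_W(X) + P_W(X))` WITH `P_1 = 0`**

Cell `ym3-torus` (HUMAN RULING D-0037: YM₃ on T³ is ladder rung R3 — NOT d = 4, NOT infinite volume, NOT a mass gap, NOT Clay).  Twin-width seat `ym-ust-19200-w7` (gen 11);
pen (L5a) assigned by the chair ★p1 g24 2026-08-29 23:14Z («(L5a) `Δ^η` term ← w7 g11»; routeR-w4 g25's hand-over); LOCATE `LOCATE-L5a-w7g11.md` c2faf3f7 (19200 evidence #59).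
THEOREMS ONLY (0 `def`, 0 `sorry`); `--supports stmt-QuantumFields-19200 --as helper`, count-neutral.  HONEST LABEL (№33 (6)): letters of a supplier row of the curved γ-row line
(LOD localisation); the (L5a) ROW itself is FILE B ✓∕⧗`Prop7LocalHessianComparison`; the `D*` third (L5b) is px12 g13's ✓`Prop7LocalDivergenceComparison`, whose letters `σ`, `Ad_σX`
and Frobenius rows this file REUSES BY NAME; nothing of (3.49), Thm 3.3∕3.11, `hGF`, `h349`, EX or the crux proved.

THE MATHEMATICS (print: [Balaban1985BackgroundPropagators] (3.4) p. 391 `(D^η_U A)(p) = Σ_{b⊂∂p} A′(b)`, (3.10) p. 392 `⟨A, ΔA⟩ = ⟨A, D*DA⟩ + ⟨A, Δ′A⟩`, and the covariance remark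
p. 393 «all the operators … are covariant with respect to gauge transformations»).
* COVARIANCE (§1).  `U₀^σ(b) = σ(b₋)U₀(b)σ(b₊)⁻¹`, `(Ad_σX)(b) = σ(b₋)X(b)σ(b₋)*`: the stencil (3.4) gives `(D¹_{U₀^σ}(Ad_σX))(p_{μν}(x)) = σ(x)·(D¹_{U₀}X)(p_{μν}(x))·σ(x)*`, hence
  `CURL_{U₀^σ}(Ad_σX) = CURL_{U₀}(X)`, `CURL_W(X) := Σ_{posPlaq} ‖(D¹_WX)(p)‖_F²` (Frobenius norms are `Ad`-invariant, px12's ✓`sum_normSq_conj_eq`).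
* CLOSENESS (§2).  `((D¹_V − D¹_1)Y)(p_{μν}(x)) = (V(x,μ)Y_ν(x+e_μ)V(x,μ)* − Y_ν(x+e_μ)) − (V(x,ν)Y_μ(x+e_ν)V(x,ν)* − Y_μ(x+e_ν))` — ZEROTH order in `Y`: the edge `⟨x, μ⟩` transports
  the field sitting on the ADJACENT edge `⟨x + e_μ, ν⟩`; `‖VZV* − Z‖_F² ≤ 4‖V − 1‖²‖Z‖_F²`; each bond value is the adjacent slot of `d − 1 = 2` edges; so
  `Σ_{posPlaq}‖(D¹_V − D¹_1)Y‖_F² ≤ 16δ²Σ_b‖Y_b‖_F²` as soon as `‖V(x,μ) − 1‖ ≤ δ` whenever `Y(x + e_μ, ν) ≠ 0`, `ν ≠ μ` — NO condition away from `supp Y` (★p1's pin (P1)).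
* DICTIONARY (§3).  ✓`Prop7DeltaEtaAlmostPositive.re_inner_DeltaEta_toL2_eq` with the `D¹*D¹` part read as a sum of squares (✓`…covCodiffCurlT_eq_sum_sq`): `re⟪X̃, Δ^η(W)X̃⟫ =
  c₀η⁻²·(CURL_W(X) + P_W(X))`, `|P_W(X)| ≤ 1029·ε₀η²·Σ_b‖X_b‖_F²` on `RegPr F n K ε₀ W` (✓`Prop7DeltaPrimeL2Bound`), and `P_1(X) = 0` (the bound at every `ε₀ > 0`, lit ✓`regPr_one`),
  so `re⟪Ỹ, Δ^η(1)Ỹ⟫ = c₀η⁻²·CURL_1(Y)` in the SAME `posPlaq` letters (cross-check: ✓`Prop7LaplaceAFlatLetters.re_inner_DeltaEta_one` in `LatticeFieldCalculus` letters).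

WHAT IS PROVED (ns `…Theorems.Prop7CovariantCurlGaugeComparison`): §1 `curl_apply` (the stencil (3.4) on the route's matrices), `conj_slot`, ★`curl_gaugeAct_conj`, ★`curlSq_gaugeAct_conj_eq`;
§2 `curl_sub_curl_one_apply`, `sum_normSq_mul_mul_star_sub_le`, ★★`curlSq_sub_le`; §3 `re_inner_DeltaEta_toL2_eq_curlSq_add`, `abs_curvPart_le`, ★`curvPart_one_eq_zero`,
★`re_inner_DeltaEta_one_toL2_eq_curlSq`, `sum_norm_sq_frobEquiv_symm_eq`.
HONEST SCOPE.  Algebra of the stencil (3.4) and Frobenius bookkeeping over landed dictionaries; no estimate of Bałaban's is asserted beyond the cited tree theorems.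

References: T. Bałaban, CMP **99** (1985) 389–434 [Balaban1985BackgroundPropagators] ((3.3)–(3.5) p.391, (3.4) p.391, (3.10)–(3.12) p.392, p.393, (3.69) p.404); CMP **99** (1985) 75–102
[Balaban1985RegularSpaces] (Lemma 1 (1.25) p.79); CMP **98** (1985) 17–51 [Balaban1985Averaging] ((18)–(20) p.21); CMP **95** (1984) 17–40 [Balaban1984PropagatorsI] ((1.4) p.18).
-/

set_option autoImplicit false

noncomputable section

open scoped Matrix.Norms.L2Operator BigOperators Matrix InnerProductSpace ComplexConjugate

namespace Summit.QuantumFields.YangMills.Theorems.Prop7CovariantCurlGaugeComparison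

open Literature.MathematicalPhysics.QuantumFieldTheory.Balaban1983to89
open Literature.MathematicalPhysics.QuantumFieldTheory.Balaban1983to89.T3ContinuumYM3Torus
open Literature.MathematicalPhysics.QuantumFieldTheory.Balaban1983to89.T3PrintedRegularMinimiser (RegPr regPr_one)
open T3SectALandauChart (formComp bgUnits covCodiffCurlT eta eta_pos)
open B9Eq39Adjoint (R R_def covD curl posPlaq)
open B9Eq310Hermitian (deltaPrimeOp)
open B10Eq27TorusAxialLog (unitsField toUField unitsField_mem_unitaryUnits)
open B9TorusCalculus (torusT torusT_apply)
open B11Eq103H1Complex (BondL2K)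
open Summit.QuantumFields.YangMills.Theorems.Prop7SectET3Transport (periodsT3)
open Summit.QuantumFields.YangMills.Theorems.Prop7SectET3HilbertLetters (W₂ frobEquiv toL2)
open Summit.QuantumFields.YangMills.Theorems.Prop7SectET3WilsonHessian (DeltaEta)
open Summit.QuantumFields.YangMills.Theorems.Prop7CovariantCoercivity (coe_inv_eq_star)
open Summit.QuantumFields.YangMills.Theorems.Prop7RieszTauFrobNorm (norm_sq_frobEquiv_symm)
open Summit.QuantumFields.YangMills.Theorems.Prop7DeltaEtaAlmostPositive (re_inner_DeltaEta_toL2_eq sum_trace_conjTranspose_mul_covCodiffCurlT_eq_sum_sq norm_toL2_sq)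
open Summit.QuantumFields.YangMills.Theorems.Prop7DeltaPrimeL2Bound (norm_sum_trace_conjTranspose_mul_deltaPrimeOp_le)
open Summit.QuantumFields.YangMills.Theorems.Prop7LocalDivergenceComparison (abs_sq_norm_sub_sq_norm_le sum_normSq_mul_le_opNorm_sq_mul sum_normSq_mul_le_mul_opNorm_sq
  sum_normSq_add_le sum_normSq_conj_eq norm_toL2_conj_eq)

/-! ## §1 The covariant curl (3.4) on the route's matrices and its exact gauge covariance -/

section Curl

variable {F : T3Family} {K : ℕ}

/-- **THE STENCIL (3.4) ON THE ROUTE'S MATRICES**: `(D¹_{U₀}A)(p_{μν}(x)) = (U₀(x,μ)·A_ν(x+e_μ)·U₀(x,μ)* − A_ν(x)) − (U₀(x,ν)·A_μ(x+e_ν)·U₀(x,ν)* − A_μ(x))` — lit ✓`B9Eq39Adjoint.curl`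
at the member's units field, with `U⁻¹ = U*` (unitarity). [cite: Balaban1985BackgroundPropagators, (3.3)–(3.5) p.391] -/
theorem curl_apply (U₀ : GaugeField (F.P K) 0 (Matrix.specialUnitaryGroup (Fin 2) ℂ)) (A : Fin (F.P K).d → Site (F.P K) 0 → Matrix (Fin 2) (Fin 2) ℂ)
    (μ ν : Fin (F.P K).d) (x : Site (F.P K) 0) :
    curl (torusT (F.P K) 0) (fun κ z => unitsField (toUField U₀) ⟨z, κ⟩) A μ ν x
      = ((U₀ ⟨x, μ⟩ : Matrix (Fin 2) (Fin 2) ℂ) * A ν (x.shift μ) * star (U₀ ⟨x, μ⟩ : Matrix (Fin 2) (Fin 2) ℂ) - A ν x)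
        - ((U₀ ⟨x, ν⟩ : Matrix (Fin 2) (Fin 2) ℂ) * A μ (x.shift ν) * star (U₀ ⟨x, ν⟩ : Matrix (Fin 2) (Fin 2) ℂ) - A μ x) := by
  have hu : ∀ b : PBond (F.P K) 0, ((unitsField (toUField U₀) b : (Matrix (Fin 2) (Fin 2) ℂ)ˣ) : Matrix (Fin 2) (Fin 2) ℂ) = (U₀ b : Matrix (Fin 2) (Fin 2) ℂ) := fun b => rfl
  have hui : ∀ b : PBond (F.P K) 0, (((unitsField (toUField U₀) b)⁻¹ : (Matrix (Fin 2) (Fin 2) ℂ)ˣ) : Matrix (Fin 2) (Fin 2) ℂ) = star (U₀ b : Matrix (Fin 2) (Fin 2) ℂ) := by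
    intro b
    rw [coe_inv_eq_star (B7Prop2Explicit.mem_unitaryUnits.mp (unitsField_mem_unitaryUnits (toUField U₀) b)), hu]
  simp only [curl, covD, R_def, torusT_apply, hu, hui]

/-- One transported slot under the gauge change: `(σ(x)Wσ(x′)*)·(σ(x′)Zσ(x′)*)·(σ(x)Wσ(x′)*)* − σ(x)Z₀σ(x)* = σ(x)·(WZW* − Z₀)·σ(x)*` (`σ(x′)*σ(x′) = 1`). [folklore] -/
theorem conj_slot (s s' w z z₀ : Matrix (Fin 2) (Fin 2) ℂ) (hs' : star s' * s' = 1) :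
    s * w * star s' * (s' * z * star s') * star (s * w * star s') - s * z₀ * star s = s * (w * z * star w - z₀) * star s := by
  rw [star_mul, star_mul, star_star]
  have e1 : s * w * star s' * (s' * z * star s') * (s' * (star w * star s)) = s * w * (star s' * s') * z * (star s' * s') * star w * star s := by noncomm_ring
  rw [e1, hs']
  noncomm_ring

/-- ★ **GAUGE COVARIANCE OF THE COVARIANT CURL (3.4) ON THE ROUTE CARRIERS**: for a gauge transformation `σ`, the background `U₀^σ = GaugeField.gaugeAct σ U₀` and the source-conjugated
one-form `(Ad_σA)_κ(z) = σ(z)A_κ(z)σ(z)*`, `(D¹_{U₀^σ}(Ad_σA))(p_{μν}(x)) = σ(x)·(D¹_{U₀}A)(p_{μν}(x))·σ(x)*` — «all the operators … are covariant». Sibling of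
✓`Prop7CurvedJunctionCovariance.divB_gaugeAct_conj` (the `D*` stencil). [cite: Balaban1985BackgroundPropagators, (3.4) p.391, p.393] -/
theorem curl_gaugeAct_conj (σ : GaugeTransf (F.P K) 0 (Matrix.specialUnitaryGroup (Fin 2) ℂ)) (W : GaugeField (F.P K) 0 (Matrix.specialUnitaryGroup (Fin 2) ℂ))
    (A : Fin (F.P K).d → Site (F.P K) 0 → Matrix (Fin 2) (Fin 2) ℂ) (μ ν : Fin (F.P K).d) (x : Site (F.P K) 0) :
    curl (torusT (F.P K) 0) (fun κ z => unitsField (toUField (GaugeField.gaugeAct σ W)) ⟨z, κ⟩)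
        (fun κ z => (σ z : Matrix (Fin 2) (Fin 2) ℂ) * A κ z * star (σ z : Matrix (Fin 2) (Fin 2) ℂ)) μ ν x
      = (σ x : Matrix (Fin 2) (Fin 2) ℂ) * curl (torusT (F.P K) 0) (fun κ z => unitsField (toUField W) ⟨z, κ⟩) A μ ν x * star (σ x : Matrix (Fin 2) (Fin 2) ℂ) := by
  rw [curl_apply, curl_apply]
  -- the gauged bond variable on `⟨x, κ⟩`: `σ(x)·W·σ(x+e_κ)⁻¹`
  have hb : ∀ κ : Fin (F.P K).d, ((GaugeField.gaugeAct σ W ⟨x, κ⟩ : Matrix.specialUnitaryGroup (Fin 2) ℂ) : Matrix (Fin 2) (Fin 2) ℂ)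
      = (σ x : Matrix (Fin 2) (Fin 2) ℂ) * (W ⟨x, κ⟩ : Matrix (Fin 2) (Fin 2) ℂ) * star (σ (x.shift κ) : Matrix (Fin 2) (Fin 2) ℂ) := by
    intro κ
    show (((σ x * W ⟨x, κ⟩ * (σ (PBond.tgt ⟨x, κ⟩))⁻¹ : Matrix.specialUnitaryGroup (Fin 2) ℂ)) : Matrix (Fin 2) (Fin 2) ℂ) = _
    rw [show PBond.tgt (⟨x, κ⟩ : PBond (F.P K) 0) = x.shift κ from rfl, Submonoid.coe_mul, Submonoid.coe_mul, ← Matrix.star_eq_inv]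
    rfl
  have hσ : ∀ y : Site (F.P K) 0, star (σ y : Matrix (Fin 2) (Fin 2) ℂ) * (σ y : Matrix (Fin 2) (Fin 2) ℂ) = 1 :=
    fun y => Matrix.mem_unitaryGroup_iff'.mp (σ y).2.1
  rw [hb μ, hb ν, conj_slot _ _ _ _ _ (hσ (x.shift μ)), conj_slot _ _ _ _ _ (hσ (x.shift ν))]
  noncomm_ring

/-- ★ **THE HESSIAN's CURL PART IS A GAUGE INVARIANT OF THE PAIR `(U₀, X)`**: `CURL_{U₀^σ}(Ad_σX) = CURL_{U₀}(X)`, where `CURL_W(X) = Σ_{posPlaq} ‖(D¹_WX)(p)‖_F²` is the sum of squares of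
✓`sum_trace_conjTranspose_mul_covCodiffCurlT_eq_sum_sq` (Frobenius norms are `Ad`-invariant). [cite: Balaban1985BackgroundPropagators, (3.4) p.391, (3.10) p.392, p.393; Balaban1985Averaging, (18) p.21] -/
theorem curlSq_gaugeAct_conj_eq (σ : GaugeTransf (F.P K) 0 (Matrix.specialUnitaryGroup (Fin 2) ℂ)) (W : GaugeField (F.P K) 0 (Matrix.specialUnitaryGroup (Fin 2) ℂ))
    (X : PBond (F.P K) 0 → Matrix (Fin 2) (Fin 2) ℂ) :
    ∑ q ∈ posPlaq (Site (F.P K) 0) (Fin (F.P K).d),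
        ‖(frobEquiv.symm (curl (torusT (F.P K) 0) (fun μ x => bgUnits F K (GaugeField.gaugeAct σ W) ⟨x, μ⟩)
          (formComp (fun b => (σ b.src : Matrix (Fin 2) (Fin 2) ℂ) * X b * star (σ b.src : Matrix (Fin 2) (Fin 2) ℂ))) q.2.1 q.2.2 q.1) : W₂)‖ ^ 2
      = ∑ q ∈ posPlaq (Site (F.P K) 0) (Fin (F.P K).d),
        ‖(frobEquiv.symm (curl (torusT (F.P K) 0) (fun μ x => bgUnits F K W ⟨x, μ⟩) (formComp X) q.2.1 q.2.2 q.1) : W₂)‖ ^ 2 := by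
  refine Finset.sum_congr rfl fun q _ => ?_
  have h1 : curl (torusT (F.P K) 0) (fun μ x => bgUnits F K (GaugeField.gaugeAct σ W) ⟨x, μ⟩)
        (formComp (fun b => (σ b.src : Matrix (Fin 2) (Fin 2) ℂ) * X b * star (σ b.src : Matrix (Fin 2) (Fin 2) ℂ))) q.2.1 q.2.2 q.1
      = (σ q.1 : Matrix (Fin 2) (Fin 2) ℂ) * curl (torusT (F.P K) 0) (fun μ x => bgUnits F K W ⟨x, μ⟩) (formComp X) q.2.1 q.2.2 q.1 * star (σ q.1 : Matrix (Fin 2) (Fin 2) ℂ) :=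
    curl_gaugeAct_conj σ W (fun κ z => X ⟨z, κ⟩) q.2.1 q.2.2 q.1
  rw [h1, norm_sq_frobEquiv_symm, norm_sq_frobEquiv_symm, sum_normSq_conj_eq]

end Curl

/-! ## §2 Zeroth-order closeness of `D¹_V` to the flat `D¹_1` next to the support -/

section Closeness

variable {F : T3Family} {K : ℕ}

/-- **THE DIFFERENCE STENCIL**: `((D¹_V − D¹_1)Y)(p_{μν}(x)) = (V(x,μ)Y_ν(x+e_μ)V(x,μ)* − Y_ν(x+e_μ)) − (V(x,ν)Y_μ(x+e_ν)V(x,ν)* − Y_μ(x+e_ν))` — the untransported letters cancel; what is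
left is ZEROTH order in `Y`: the edge `⟨x, μ⟩` transports the field on the ADJACENT edge `⟨x + e_μ, ν⟩`. [cite: Balaban1985BackgroundPropagators, (3.4) p.391] -/
theorem curl_sub_curl_one_apply (V : GaugeField (F.P K) 0 (Matrix.specialUnitaryGroup (Fin 2) ℂ)) (Y : Fin (F.P K).d → Site (F.P K) 0 → Matrix (Fin 2) (Fin 2) ℂ)
    (μ ν : Fin (F.P K).d) (x : Site (F.P K) 0) :
    curl (torusT (F.P K) 0) (fun κ z => unitsField (toUField V) ⟨z, κ⟩) Y μ ν x
        - curl (torusT (F.P K) 0) (fun κ z => unitsField (toUField (1 : GaugeField (F.P K) 0 (Matrix.specialUnitaryGroup (Fin 2) ℂ))) ⟨z, κ⟩) Y μ ν x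
      = ((V ⟨x, μ⟩ : Matrix (Fin 2) (Fin 2) ℂ) * Y ν (x.shift μ) * star (V ⟨x, μ⟩ : Matrix (Fin 2) (Fin 2) ℂ) - Y ν (x.shift μ))
        - ((V ⟨x, ν⟩ : Matrix (Fin 2) (Fin 2) ℂ) * Y μ (x.shift ν) * star (V ⟨x, ν⟩ : Matrix (Fin 2) (Fin 2) ℂ) - Y μ (x.shift ν)) := by
  rw [curl_apply, curl_apply]
  have h1 : ∀ κ : Fin (F.P K).d, (((1 : GaugeField (F.P K) 0 (Matrix.specialUnitaryGroup (Fin 2) ℂ)) ⟨x, κ⟩ : Matrix.specialUnitaryGroup (Fin 2) ℂ) :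
      Matrix (Fin 2) (Fin 2) ℂ) = 1 := fun κ => rfl
  rw [h1 μ, h1 ν, star_one, Matrix.one_mul, Matrix.mul_one, Matrix.one_mul, Matrix.mul_one]
  abel

/-- **`Σ_{jk}|(VZV* − Z)_{jk}|² ≤ 4‖V − 1‖²·Σ_{jk}|Z_{jk}|²`** for `V ∈ SU(2)`: `VZV* − Z = (V − 1)ZV* + Z(V − 1)*`, `‖V*‖ = 1`, `‖(V − 1)*‖ = ‖V − 1‖` (companion of px12's
✓`sum_normSq_star_mul_mul_sub_le`, transporter on the other side). [cite: Balaban1985Averaging, (18)–(20) p.21] -/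
theorem sum_normSq_mul_mul_star_sub_le (V : Matrix.specialUnitaryGroup (Fin 2) ℂ) (Z : Matrix (Fin 2) (Fin 2) ℂ) :
    ∑ j, ∑ k, ‖((V : Matrix (Fin 2) (Fin 2) ℂ) * Z * star (V : Matrix (Fin 2) (Fin 2) ℂ) - Z) j k‖ ^ 2
      ≤ 4 * ‖(V : Matrix (Fin 2) (Fin 2) ℂ) - 1‖ ^ 2 * ∑ j, ∑ k, ‖Z j k‖ ^ 2 := by
  set v : Matrix (Fin 2) (Fin 2) ℂ := (V : Matrix (Fin 2) (Fin 2) ℂ) with hv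
  have hid : v * Z * star v - Z = (v - 1) * (Z * star v) + Z * star (v - 1) := by
    rw [star_sub, star_one]; noncomm_ring
  have hstar : ‖star v‖ ≤ 1 := by
    rw [Matrix.star_eq_conjTranspose, Matrix.l2_opNorm_conjTranspose]
    exact (CStarRing.norm_coe_unitary ⟨v, Matrix.specialUnitaryGroup_le_unitaryGroup V.2⟩).le
  have hstar1 : ‖star (v - 1)‖ = ‖v - 1‖ := by
    rw [Matrix.star_eq_conjTranspose, Matrix.l2_opNorm_conjTranspose]
  have hZ : 0 ≤ ∑ j, ∑ k, ‖Z j k‖ ^ 2 := Finset.sum_nonneg fun j _ => Finset.sum_nonneg fun k _ => sq_nonneg _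
  calc ∑ j, ∑ k, ‖(v * Z * star v - Z) j k‖ ^ 2
        = ∑ j, ∑ k, ‖((v - 1) * (Z * star v) + Z * star (v - 1)) j k‖ ^ 2 := by rw [hid]
    _ ≤ 2 * ∑ j, ∑ k, ‖((v - 1) * (Z * star v)) j k‖ ^ 2 + 2 * ∑ j, ∑ k, ‖(Z * star (v - 1)) j k‖ ^ 2 := sum_normSq_add_le _ _
    _ ≤ 2 * (‖v - 1‖ ^ 2 * ∑ j, ∑ k, ‖(Z * star v) j k‖ ^ 2) + 2 * (‖star (v - 1)‖ ^ 2 * ∑ j, ∑ k, ‖Z j k‖ ^ 2) := by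
        gcongr
        · exact sum_normSq_mul_le_opNorm_sq_mul _ _
        · exact sum_normSq_mul_le_mul_opNorm_sq _ _
    _ ≤ 2 * (‖v - 1‖ ^ 2 * (1 * ∑ j, ∑ k, ‖Z j k‖ ^ 2)) + 2 * (‖v - 1‖ ^ 2 * ∑ j, ∑ k, ‖Z j k‖ ^ 2) := by
        rw [hstar1]
        gcongr
        calc ∑ j, ∑ k, ‖(Z * star v) j k‖ ^ 2 ≤ ‖star v‖ ^ 2 * ∑ j, ∑ k, ‖Z j k‖ ^ 2 := sum_normSq_mul_le_mul_opNorm_sq _ _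
          _ ≤ 1 * ∑ j, ∑ k, ‖Z j k‖ ^ 2 := by
              refine mul_le_mul_of_nonneg_right ?_ hZ
              calc ‖star v‖ ^ 2 ≤ 1 ^ 2 := pow_le_pow_left₀ (norm_nonneg _) hstar 2
                _ = 1 := one_pow 2
    _ = 4 * ‖v - 1‖ ^ 2 * ∑ j, ∑ k, ‖Z j k‖ ^ 2 := by ring

/-- ★★ **ZEROTH-ORDER CLOSENESS OF `D¹_V` TO THE FLAT `D¹_1` NEXT TO THE SUPPORT** (★p1's pin (P1), curl version): if `‖V(x,μ) − 1‖ ≤ δ` for every edge `⟨x, μ⟩` ADJACENT to the support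
of `Y` (i.e. whenever `Y(x + e_μ, ν) ≠ 0` for some `ν ≠ μ`), then `Σ_{posPlaq} ‖((D¹_V − D¹_1)Y)(p)‖_F² ≤ 16·δ²·Σ_b‖Y_b‖_F²` (`16 = 2·4·(d − 1)`, `d = 3`: two transported slots per
plaquette, `4‖V − 1‖²` each, every bond value the adjacent slot of `d − 1` edges).  No hypothesis away from the support of `Y`.
[cite: Balaban1985BackgroundPropagators, (3.4) p.391; Balaban1985RegularSpaces, Lemma 1 (1.25) p.79] -/
theorem curlSq_sub_le (V : GaugeField (F.P K) 0 (Matrix.specialUnitaryGroup (Fin 2) ℂ)) (Y : PBond (F.P K) 0 → Matrix (Fin 2) (Fin 2) ℂ) {δ : ℝ}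
    (hV : ∀ (x : Site (F.P K) 0) (μ ν : Fin (F.P K).d), μ ≠ ν → Y ⟨x.shift μ, ν⟩ ≠ 0 → ‖(V ⟨x, μ⟩ : Matrix (Fin 2) (Fin 2) ℂ) - 1‖ ≤ δ) :
    ∑ q ∈ posPlaq (Site (F.P K) 0) (Fin (F.P K).d),
        ‖(frobEquiv.symm (curl (torusT (F.P K) 0) (fun μ x => bgUnits F K V ⟨x, μ⟩) (formComp Y) q.2.1 q.2.2 q.1
            - curl (torusT (F.P K) 0) (fun μ x => bgUnits F K (1 : GaugeField (F.P K) 0 (Matrix.specialUnitaryGroup (Fin 2) ℂ)) ⟨x, μ⟩) (formComp Y) q.2.1 q.2.2 q.1) : W₂)‖ ^ 2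
      ≤ 16 * δ ^ 2 * ∑ b : PBond (F.P K) 0, ∑ j, ∑ k, ‖Y b j k‖ ^ 2 := by
  have hd : (F.P K).d = 3 := rfl
  -- one transported slot: `Σ|VZV* − Z|² ≤ 4δ²Σ|Z|²` on the adjacent-edge row (trivial where `Z = 0`)
  have hslot : ∀ (x : Site (F.P K) 0) (μ ν : Fin (F.P K).d), μ ≠ ν →
      ∑ j, ∑ k, ‖((V ⟨x, μ⟩ : Matrix (Fin 2) (Fin 2) ℂ) * Y ⟨x.shift μ, ν⟩ * star (V ⟨x, μ⟩ : Matrix (Fin 2) (Fin 2) ℂ) - Y ⟨x.shift μ, ν⟩) j k‖ ^ 2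
        ≤ 4 * δ ^ 2 * ∑ j, ∑ k, ‖Y ⟨x.shift μ, ν⟩ j k‖ ^ 2 := by
    intro x μ ν hμν
    by_cases hY : Y ⟨x.shift μ, ν⟩ = 0
    · simp [hY]
    · calc _ ≤ 4 * ‖(V ⟨x, μ⟩ : Matrix (Fin 2) (Fin 2) ℂ) - 1‖ ^ 2 * ∑ j, ∑ k, ‖Y ⟨x.shift μ, ν⟩ j k‖ ^ 2 := sum_normSq_mul_mul_star_sub_le (V ⟨x, μ⟩) _
        _ ≤ 4 * δ ^ 2 * ∑ j, ∑ k, ‖Y ⟨x.shift μ, ν⟩ j k‖ ^ 2 := by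
            have h1 : ‖(V ⟨x, μ⟩ : Matrix (Fin 2) (Fin 2) ℂ) - 1‖ ^ 2 ≤ δ ^ 2 := pow_le_pow_left₀ (norm_nonneg _) (hV x μ ν hμν hY) 2
            have h2 : 0 ≤ ∑ j, ∑ k, ‖Y ⟨x.shift μ, ν⟩ j k‖ ^ 2 := Finset.sum_nonneg fun j _ => Finset.sum_nonneg fun k _ => sq_nonneg _
            nlinarith
  -- per plaquette `(x; μ, ν)`, `μ ≠ ν`
  have hplaq : ∀ (x : Site (F.P K) 0) (μ ν : Fin (F.P K).d), μ ≠ ν →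
      ‖(frobEquiv.symm (curl (torusT (F.P K) 0) (fun μ x => bgUnits F K V ⟨x, μ⟩) (formComp Y) μ ν x
            - curl (torusT (F.P K) 0) (fun μ x => bgUnits F K (1 : GaugeField (F.P K) 0 (Matrix.specialUnitaryGroup (Fin 2) ℂ)) ⟨x, μ⟩) (formComp Y) μ ν x) : W₂)‖ ^ 2
        ≤ 8 * δ ^ 2 * (∑ j, ∑ k, ‖Y ⟨x.shift μ, ν⟩ j k‖ ^ 2) + 8 * δ ^ 2 * (∑ j, ∑ k, ‖Y ⟨x.shift ν, μ⟩ j k‖ ^ 2) := by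
    intro x μ ν hμν
    rw [norm_sq_frobEquiv_symm]
    have hcs := curl_sub_curl_one_apply V (fun κ z => Y ⟨z, κ⟩) μ ν x
    -- `bgUnits = unitsField ∘ toUField`, `formComp Y κ z = Y ⟨z, κ⟩` (both by `rfl`)
    change ∑ j, ∑ k, ‖(curl (torusT (F.P K) 0) (fun κ z => unitsField (toUField V) ⟨z, κ⟩) (fun κ z => Y ⟨z, κ⟩) μ ν x
        - curl (torusT (F.P K) 0) (fun κ z => unitsField (toUField (1 : GaugeField (F.P K) 0 (Matrix.specialUnitaryGroup (Fin 2) ℂ))) ⟨z, κ⟩) (fun κ z => Y ⟨z, κ⟩) μ ν x) j k‖ ^ 2 ≤ _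
    rw [hcs, sub_eq_add_neg]
    calc _ ≤ 2 * ∑ j, ∑ k, ‖((V ⟨x, μ⟩ : Matrix (Fin 2) (Fin 2) ℂ) * Y ⟨x.shift μ, ν⟩ * star (V ⟨x, μ⟩ : Matrix (Fin 2) (Fin 2) ℂ) - Y ⟨x.shift μ, ν⟩) j k‖ ^ 2
          + 2 * ∑ j, ∑ k, ‖(-((V ⟨x, ν⟩ : Matrix (Fin 2) (Fin 2) ℂ) * Y ⟨x.shift ν, μ⟩ * star (V ⟨x, ν⟩ : Matrix (Fin 2) (Fin 2) ℂ) - Y ⟨x.shift ν, μ⟩)) j k‖ ^ 2 :=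
          sum_normSq_add_le _ _
      _ = 2 * ∑ j, ∑ k, ‖((V ⟨x, μ⟩ : Matrix (Fin 2) (Fin 2) ℂ) * Y ⟨x.shift μ, ν⟩ * star (V ⟨x, μ⟩ : Matrix (Fin 2) (Fin 2) ℂ) - Y ⟨x.shift μ, ν⟩) j k‖ ^ 2
          + 2 * ∑ j, ∑ k, ‖((V ⟨x, ν⟩ : Matrix (Fin 2) (Fin 2) ℂ) * Y ⟨x.shift ν, μ⟩ * star (V ⟨x, ν⟩ : Matrix (Fin 2) (Fin 2) ℂ) - Y ⟨x.shift ν, μ⟩) j k‖ ^ 2 := by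
          simp only [Matrix.neg_apply, norm_neg]
      _ ≤ 2 * (4 * δ ^ 2 * ∑ j, ∑ k, ‖Y ⟨x.shift μ, ν⟩ j k‖ ^ 2) + 2 * (4 * δ ^ 2 * ∑ j, ∑ k, ‖Y ⟨x.shift ν, μ⟩ j k‖ ^ 2) := by
          gcongr
          · exact hslot x μ ν hμν
          · exact hslot x ν μ (Ne.symm hμν)
      _ = _ := by ring
  -- sum over the positive plaquettes: `Σ_{x, μ<ν} (S_{x+μ,ν} + S_{x+ν,μ}) = Σ_{x, μ≠ν} S_{x+μ,ν} ≤ Σ_{x,μ,ν} … = …`; we bound crudely but exactly enough: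
  -- `Σ_{μ<ν}(S(x+e_μ,ν) + S(x+e_ν,μ)) = Σ_{μ≠ν} S(x+e_μ,ν)` and `Σ_x Σ_{μ≠ν} S(x+e_μ,ν) = (d−1)·Σ_b S_b`
  set S : Site (F.P K) 0 → Fin (F.P K).d → ℝ := fun y ν => ∑ j, ∑ k, ‖Y ⟨y, ν⟩ j k‖ ^ 2 with hS
  have hS0 : ∀ y ν, 0 ≤ S y ν := fun y ν => Finset.sum_nonneg fun j _ => Finset.sum_nonneg fun k _ => sq_nonneg _
  -- Step 1: the plaquette sum is bounded by `8δ²·Σ_x Σ_{(μ,ν)} [μ<ν](S (x+μ) ν + S (x+ν) μ)`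
  have hstep1 : ∑ q ∈ posPlaq (Site (F.P K) 0) (Fin (F.P K).d),
        ‖(frobEquiv.symm (curl (torusT (F.P K) 0) (fun μ x => bgUnits F K V ⟨x, μ⟩) (formComp Y) q.2.1 q.2.2 q.1
            - curl (torusT (F.P K) 0) (fun μ x => bgUnits F K (1 : GaugeField (F.P K) 0 (Matrix.specialUnitaryGroup (Fin 2) ℂ)) ⟨x, μ⟩) (formComp Y) q.2.1 q.2.2 q.1) : W₂)‖ ^ 2
      ≤ ∑ q ∈ posPlaq (Site (F.P K) 0) (Fin (F.P K).d), 8 * δ ^ 2 * (S (q.1.shift q.2.1) q.2.2 + S (q.1.shift q.2.2) q.2.1) := by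
    refine Finset.sum_le_sum fun q hq => ?_
    have hμν : q.2.1 ≠ q.2.2 := ne_of_lt (Finset.mem_filter.mp hq).2
    have := hplaq q.1 q.2.1 q.2.2 hμν
    rw [hS]
    linarith
  -- Step 2: `Σ_{posPlaq} (S(x+μ,ν) + S(x+ν,μ)) = Σ_x Σ_{μ≠ν} S(x+μ,ν)` (the two halves of the ordered-pair sum)
  have hx : ∀ x : Site (F.P K) 0, ∑ μ : Fin (F.P K).d, ∑ ν : Fin (F.P K).d, (if μ < ν then S (x.shift μ) ν + S (x.shift ν) μ else 0)
      = ∑ μ : Fin (F.P K).d, ∑ ν : Fin (F.P K).d, (if μ ≠ ν then S (x.shift μ) ν else 0) := by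
    intro x
    have hA : ∑ μ : Fin (F.P K).d, ∑ ν : Fin (F.P K).d, (if μ < ν then S (x.shift μ) ν + S (x.shift ν) μ else 0)
        = ∑ μ : Fin (F.P K).d, ∑ ν : Fin (F.P K).d, (if μ < ν then S (x.shift μ) ν else 0)
          + ∑ μ : Fin (F.P K).d, ∑ ν : Fin (F.P K).d, (if μ < ν then S (x.shift ν) μ else 0) := by
      rw [← Finset.sum_add_distrib]
      refine Finset.sum_congr rfl fun μ _ => ?_
      rw [← Finset.sum_add_distrib]
      refine Finset.sum_congr rfl fun ν _ => ?_
      split_ifs <;> simp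
    have hB : ∑ μ : Fin (F.P K).d, ∑ ν : Fin (F.P K).d, (if μ < ν then S (x.shift ν) μ else 0)
        = ∑ μ : Fin (F.P K).d, ∑ ν : Fin (F.P K).d, (if ν < μ then S (x.shift μ) ν else 0) := Finset.sum_comm
    rw [hA, hB, ← Finset.sum_add_distrib]
    refine Finset.sum_congr rfl fun μ _ => ?_
    rw [← Finset.sum_add_distrib]
    refine Finset.sum_congr rfl fun ν _ => ?_
    rcases lt_trichotomy μ ν with h | h | h
    · rw [if_pos h, if_neg (not_lt.mpr h.le), if_pos (ne_of_lt h), add_zero]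
    · rw [if_neg (lt_irrefl _ ∘ (h ▸ ·)), if_neg (lt_irrefl _ ∘ (h ▸ ·)), if_neg (fun hne => hne h), add_zero]
    · rw [if_neg (not_lt.mpr h.le), if_pos h, if_pos (ne_of_lt h).symm, zero_add]
  have hstep2 : ∑ q ∈ posPlaq (Site (F.P K) 0) (Fin (F.P K).d), (S (q.1.shift q.2.1) q.2.2 + S (q.1.shift q.2.2) q.2.1)
      = ∑ x : Site (F.P K) 0, ∑ μ : Fin (F.P K).d, ∑ ν : Fin (F.P K).d, (if μ ≠ ν then S (x.shift μ) ν else 0) := by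
    rw [B9Eq39Adjoint.sum_posPlaq (fun (x : Site (F.P K) 0) (μ ν : Fin (F.P K).d) => S (x.shift μ) ν + S (x.shift ν) μ)]
    exact Finset.sum_congr rfl fun x _ => hx x
  -- Step 3: `Σ_x Σ_μ Σ_ν [μ≠ν] S(x+μ,ν) = Σ_μ Σ_{ν≠μ} Σ_y S(y,ν) ≤ (d−1)·Σ_ν Σ_y S(y,ν) = 2·Σ_b S_b`
  have hstep3 : ∑ x : Site (F.P K) 0, ∑ μ : Fin (F.P K).d, ∑ ν : Fin (F.P K).d, (if μ ≠ ν then S (x.shift μ) ν else 0)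
      ≤ 2 * ∑ b : PBond (F.P K) 0, ∑ j, ∑ k, ‖Y b j k‖ ^ 2 := by
    -- reindex `x ↦ x.shift μ` (a permutation of the torus) inside, for each fixed `μ, ν`
    have hre : ∀ μ ν : Fin (F.P K).d, ∑ x : Site (F.P K) 0, S (x.shift μ) ν = ∑ y : Site (F.P K) 0, S y ν := fun μ ν =>
      Fintype.sum_equiv (B10StarCount.shiftEquiv μ) (fun x => S (x.shift μ) ν) (fun y => S y ν) (fun _ => rfl)
    have hcomm : ∑ x : Site (F.P K) 0, ∑ μ : Fin (F.P K).d, ∑ ν : Fin (F.P K).d, (if μ ≠ ν then S (x.shift μ) ν else 0)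
        = ∑ μ : Fin (F.P K).d, ∑ ν : Fin (F.P K).d, (if μ ≠ ν then ∑ y : Site (F.P K) 0, S y ν else 0) := by
      rw [Finset.sum_comm]
      refine Finset.sum_congr rfl fun μ _ => ?_
      rw [Finset.sum_comm]
      refine Finset.sum_congr rfl fun ν _ => ?_
      split_ifs with h
      · exact hre μ ν
      · simp
    rw [hcomm]
    -- the bond sum: `Σ_b S_b = Σ_ν Σ_y S(y,ν)`
    have hbond : ∑ b : PBond (F.P K) 0, ∑ j, ∑ k, ‖Y b j k‖ ^ 2 = ∑ ν : Fin (F.P K).d, ∑ y : Site (F.P K) 0, S y ν := by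
      rw [B10StarCount.sum_pbond, Finset.sum_comm]
    rw [hbond]
    -- for each `ν`: `Σ_μ [μ≠ν] T_ν = (d−1)·T_ν = 2·T_ν`
    have hT0 : ∀ ν : Fin (F.P K).d, 0 ≤ ∑ y : Site (F.P K) 0, S y ν := fun ν => Finset.sum_nonneg fun y _ => hS0 y ν
    rw [Finset.sum_comm, Finset.mul_sum]
    refine Finset.sum_le_sum fun ν _ => ?_
    have hcount : ∑ μ : Fin (F.P K).d, (if μ ≠ ν then ∑ y : Site (F.P K) 0, S y ν else 0)
        = ((Finset.univ.filter fun μ : Fin (F.P K).d => μ ≠ ν).card : ℝ) * ∑ y : Site (F.P K) 0, S y ν := by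
      rw [← Finset.sum_filter, Finset.sum_const, nsmul_eq_mul]
    rw [hcount]
    have hcard : ((Finset.univ.filter fun μ : Fin (F.P K).d => μ ≠ ν).card : ℝ) = 2 := by
      have : (Finset.univ.filter fun μ : Fin (F.P K).d => μ ≠ ν).card = 2 := by
        rw [Finset.filter_ne' Finset.univ ν, Finset.card_erase_of_mem (Finset.mem_univ ν), Finset.card_univ, Fintype.card_fin, hd]
      exact_mod_cast this
    rw [hcard]
  have hδ2 : 0 ≤ 8 * δ ^ 2 := by positivity
  calc _ ≤ ∑ q ∈ posPlaq (Site (F.P K) 0) (Fin (F.P K).d), 8 * δ ^ 2 * (S (q.1.shift q.2.1) q.2.2 + S (q.1.shift q.2.2) q.2.1) := hstep1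
    _ = 8 * δ ^ 2 * ∑ q ∈ posPlaq (Site (F.P K) 0) (Fin (F.P K).d), (S (q.1.shift q.2.1) q.2.2 + S (q.1.shift q.2.2) q.2.1) := by rw [Finset.mul_sum]
    _ ≤ 8 * δ ^ 2 * (2 * ∑ b : PBond (F.P K) 0, ∑ j, ∑ k, ‖Y b j k‖ ^ 2) := mul_le_mul_of_nonneg_left (hstep2.le.trans hstep3) hδ2
    _ = 16 * δ ^ 2 * ∑ b : PBond (F.P K) 0, ∑ j, ∑ k, ‖Y b j k‖ ^ 2 := by ring

end Closeness

/-! ## §3 The dictionary of `re⟪X̃, Δ^η(W)X̃⟫` in real form; the curvature part vanishes at the flat background -/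

section Dictionary

variable {F : T3Family} {n K : ℕ} {c₀ : ℝ} [Fact (0 < c₀)]

/-- **THE FORM OF `Δ^η(W)` IN REAL LETTERS**: `re⟪X̃, Δ^η(W)X̃⟫ = c₀η⁻²·(CURL_W(X) + P_W(X))` with `CURL_W(X) = Σ_{posPlaq} ‖(D¹_WX)(p)‖_F²` and the curvature part
`P_W(X) = re Σ_b tr(X_b†(Δ′_WX)_b)` — ✓`re_inner_DeltaEta_toL2_eq` with the `D¹*D¹` part read as a sum of squares (✓`sum_trace_conjTranspose_mul_covCodiffCurlT_eq_sum_sq`).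
[cite: Balaban1985BackgroundPropagators, (3.10)–(3.12) p.392] -/
theorem re_inner_DeltaEta_toL2_eq_curlSq_add (W : GaugeField (F.P K) 0 (Matrix.specialUnitaryGroup (Fin 2) ℂ)) (X : PBond (F.P K) 0 → Matrix (Fin 2) (Fin 2) ℂ) :
    RCLike.re ⟪toL2 F K c₀ X, DeltaEta F n K c₀ W (toL2 F K c₀ X)⟫_ℂ
      = c₀ * (eta F n K)⁻¹ ^ 2 *
        ((∑ q ∈ posPlaq (Site (F.P K) 0) (Fin (F.P K).d),
            ‖(frobEquiv.symm (curl (torusT (F.P K) 0) (fun μ x => bgUnits F K W ⟨x, μ⟩) (formComp X) q.2.1 q.2.2 q.1) : W₂)‖ ^ 2)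
          + (∑ b : PBond (F.P K) 0, Matrix.trace ((X b).conjTranspose
              * deltaPrimeOp (torusT (F.P K) 0) (fun μ x => bgUnits F K W ⟨x, μ⟩) 1 (formComp X) b.dir b.src)).re) := by
  rw [re_inner_DeltaEta_toL2_eq, sum_trace_conjTranspose_mul_covCodiffCurlT_eq_sum_sq, Complex.ofReal_re]

/-- **THE CURVATURE PART IS `O(ε₀η²)` IN `L²`** on `RegPr F n K ε₀ W`: `|P_W(X)| ≤ 1029·(ε₀η²)·Σ_b ‖X_b‖_F²` (✓`Prop7DeltaPrimeL2Bound`, real part).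
[cite: Balaban1985BackgroundPropagators, (3.10) p.392, (3.69) p.404] -/
theorem abs_curvPart_le {ε₀ : ℝ} (hε₀ : 0 ≤ ε₀) (W : GaugeField (F.P K) 0 (Matrix.specialUnitaryGroup (Fin 2) ℂ)) (hreg : RegPr F n K ε₀ W)
    (X : PBond (F.P K) 0 → Matrix (Fin 2) (Fin 2) ℂ) :
    |(∑ b : PBond (F.P K) 0, Matrix.trace ((X b).conjTranspose
        * deltaPrimeOp (torusT (F.P K) 0) (fun μ x => bgUnits F K W ⟨x, μ⟩) 1 (formComp X) b.dir b.src)).re|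
      ≤ 1029 * (ε₀ * eta F n K ^ 2) * ∑ b : PBond (F.P K) 0, ‖(frobEquiv.symm (X b) : W₂)‖ ^ 2 :=
  (Complex.abs_re_le_norm _).trans (norm_sum_trace_conjTranspose_mul_deltaPrimeOp_le hε₀ W hreg X)

/-- **AT THE TRIVIAL BACKGROUND THE CURVATURE PART VANISHES**: `P_1(X) = 0` — the bound of ✓`Prop7DeltaPrimeL2Bound` holds at every `ε₀ > 0` on `RegPr F n K ε₀ 1` (lit ✓`regPr_one`).
[cite: Balaban1985BackgroundPropagators, (3.10) p.392] -/
theorem curvPart_one_eq_zero (X : PBond (F.P K) 0 → Matrix (Fin 2) (Fin 2) ℂ) :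
    (∑ b : PBond (F.P K) 0, Matrix.trace ((X b).conjTranspose
        * deltaPrimeOp (torusT (F.P K) 0) (fun μ x => bgUnits F K (1 : GaugeField (F.P K) 0 (Matrix.specialUnitaryGroup (Fin 2) ℂ)) ⟨x, μ⟩) 1 (formComp X)
            b.dir b.src)).re = 0 := by
  set P : ℝ := (∑ b : PBond (F.P K) 0, Matrix.trace ((X b).conjTranspose
        * deltaPrimeOp (torusT (F.P K) 0) (fun μ x => bgUnits F K (1 : GaugeField (F.P K) 0 (Matrix.specialUnitaryGroup (Fin 2) ℂ)) ⟨x, μ⟩) 1 (formComp X)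
            b.dir b.src)).re with hP
  set S : ℝ := ∑ b : PBond (F.P K) 0, ‖(frobEquiv.symm (X b) : W₂)‖ ^ 2 with hS
  have hS0 : 0 ≤ S := Finset.sum_nonneg fun b _ => sq_nonneg _
  have hη : 0 ≤ eta F K K ^ 2 := sq_nonneg _
  have h : ∀ ε : ℝ, 0 < ε → |P| ≤ 1029 * (ε * eta F K K ^ 2) * S := fun ε hε =>
    abs_curvPart_le (n := K) hε.le 1 (regPr_one (F := F) (n := K) (K := K) hε) X
  have key : |P| ≤ 0 := by
    refine le_of_forall_pos_le_add fun ε hε => ?_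
    have hpos : 0 < 1029 * eta F K K ^ 2 * S + 1 := by positivity
    have hε' : 0 < ε / (1029 * eta F K K ^ 2 * S + 1) := div_pos hε hpos
    calc |P| ≤ 1029 * (ε / (1029 * eta F K K ^ 2 * S + 1) * eta F K K ^ 2) * S := h _ hε'
      _ = ε / (1029 * eta F K K ^ 2 * S + 1) * (1029 * eta F K K ^ 2 * S) := by ring
      _ ≤ ε / (1029 * eta F K K ^ 2 * S + 1) * (1029 * eta F K K ^ 2 * S + 1) :=
          mul_le_mul_of_nonneg_left (le_add_of_nonneg_right zero_le_one) hε'.le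
      _ = ε := div_mul_cancel₀ _ hpos.ne'
      _ = 0 + ε := (zero_add ε).symm
  exact abs_eq_zero.mp (le_antisymm key (abs_nonneg _))

/-- ★ **THE FLAT HESSIAN IS THE SQUARE OF THE FLAT CURL**: `re⟪Ỹ, Δ^η(1)Ỹ⟫ = c₀η⁻²·Σ_{posPlaq} ‖(D¹_1Y)(p)‖_F²` (cross-check: ✓`Prop7LaplaceAFlatLetters.re_inner_DeltaEta_one` in
`LatticeFieldCalculus` letters). [cite: Balaban1985BackgroundPropagators, (3.10) p.392; Balaban1984PropagatorsI, (1.4) p.18] -/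
theorem re_inner_DeltaEta_one_toL2_eq_curlSq (Y : PBond (F.P K) 0 → Matrix (Fin 2) (Fin 2) ℂ) :
    RCLike.re ⟪toL2 F K c₀ Y, DeltaEta F n K c₀ (1 : GaugeField (F.P K) 0 (Matrix.specialUnitaryGroup (Fin 2) ℂ)) (toL2 F K c₀ Y)⟫_ℂ
      = c₀ * (eta F n K)⁻¹ ^ 2 *
        ∑ q ∈ posPlaq (Site (F.P K) 0) (Fin (F.P K).d),
          ‖(frobEquiv.symm (curl (torusT (F.P K) 0) (fun μ x => bgUnits F K (1 : GaugeField (F.P K) 0 (Matrix.specialUnitaryGroup (Fin 2) ℂ)) ⟨x, μ⟩)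
            (formComp Y) q.2.1 q.2.2 q.1) : W₂)‖ ^ 2 := by
  rw [re_inner_DeltaEta_toL2_eq_curlSq_add, curvPart_one_eq_zero, add_zero]

/-- `Σ_b ‖frobEquiv⁻¹ X_b‖² = Σ_b Σ_{jk} |X_b,jk|²` (entrywise Frobenius). [cite: Balaban1985Averaging, (18) p.21] -/
theorem sum_norm_sq_frobEquiv_symm_eq (X : PBond (F.P K) 0 → Matrix (Fin 2) (Fin 2) ℂ) :
    ∑ b : PBond (F.P K) 0, ‖(frobEquiv.symm (X b) : W₂)‖ ^ 2 = ∑ b : PBond (F.P K) 0, ∑ j, ∑ k, ‖X b j k‖ ^ 2 :=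
  Finset.sum_congr rfl fun b _ => norm_sq_frobEquiv_symm (X b)

end Dictionary

end Summit.QuantumFields.YangMills.Theorems.Prop7CovariantCurlGaugeComparison

end
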